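import Summits.QuantumFields.BalabanUV.Beta.FP.ConstrainedBiLaplacianSbTwoLevel

/-!
# `BalabanUV.Beta.FP.ConstrainedBiLaplacianSbTwoLevelTransfer` — road «FP», brick (g3) «(CONV-C)-Sb», THE TWO-LEG ONE-STEP LAW, FILE A2 (ALGEBRA):
# THE GENERIC ALIAS FORM `PhiDC N D C`, ITS EXACT TRANSFER UNDER TWO-LEG SUB-CELL SUMMATION
# (`Σ_{ρρ′} PhiDC (n·L) D′ C′ (Tsub τ ρ) (Tsub σ ρ′) = L^d·PhiDC n (trD D′) (trC C′) τ σ`), AND THE EXACT TRANSFER IDENTITY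
# `L^d·avgM n L s τ σ = PhiDC n (DgT) (coefT) τ σ`, `L^d·avgM − M n = PhiDC n (DgT − Dg) (coefT − coef)`

NOT IN PRINT; OUR PROOF ATTEMPT (binder row G-an2-4 ∕ (CONV-C), prover part P3 = fibre∕strip «Woodbury» lineage, gen 29; CRUX TEAM (2), 2026-08-21).
HONEST DEPENDENCY (cell records, verbatim): «continuum YM on T⁴ ⇐ BetaPertH ∧ nine spine estimates (0/9 proved); BetaPertH ⇐ (D1) ∧ (D4) ∧ CAP+tail;
G-an2-4 gates asym, D1 and NE2/3/4.»  HONEST FRAMING (cell contract, verbatim): «discharging `BetaPertH` makes Bałaban's UV stability UNCONDITIONAL — a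
real constructive-QFT result; it is NOT the continuum limit and NOT the Clay problem.»  ABSOLUTE RULE (cell charter, verbatim): «No internally-minted
statement may enter as a cited fact. Every hypothesis is either kernel-proved in this package or a verbatim quotation of a PUBLISHED theorem with page
reference. The manuscript(s) under audit are NOT citable for their own disputed steps — they are the thing under adjudication; programme-internal
(2001/route/tribunal) claims are never citable.»  THIS MODULE is [folklore] algebra over FILES W and A1 of this programme (`GP`, `GM`, `sum_EF_Tsub`,
`sum_EFc_Tsub`, `F_zero_Kof`, `Fc_zero_Kof`, `GP_mul_GM`; `Dg`, `coef`, `DgT`, `coefT`, `GT`, `M_eq_sum`), gen 28's FILE 1 (`ConstrainedBiLaplacianSubcell.avgM`)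
and gen 22's alias re-indexing (`SubAveragingFibreColumn.sum_Kof_eq`∕`Kof_injective`); it cites nothing as a hypothesis, has THREE bookkeeping `def`s
(`PhiDC`, `trD`, `trC`), no `def … : Prop`, no `sorry`.

## The mechanism (census V69; journal INTENT «SB-TWO-LEG» 2026-08-21)

Any offset-pair multiplier of the shape `PhiDC N D C τ σ = N^{−d}Σ_{KK′} EF N τ K·EFc N σ K′·([K=K′]·D K − F N 0 K·Fc N 0 K′·C K K′)` (§1; the
constrained inverse is `M N s = PhiDC N (Dg N s) (coef N s)`, `M_eq_PhiDC`) has its two-leg sub-cell SUM over the `L^d × L^d` children of a pair of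
level-`n` cells equal to `L^d` times the SAME shape at level `n` with the TRANSFERRED letters `trD D′ k = Σ_m W1(Kof k m)·D′(Kof k m)`,
`trC C′ k k′ = Σ_{mm′} W1·W1′·C′` (§2, **`sum_sum_PhiDC_Tsub`**): the sub-cell phase sums give the half-weights `GP`, `GM` (FILE W), the finer
block-averaging factors split off the complementary half-weights, and `GP·GM = W1` pairs them on the diagonal AND on both rank-one legs.  Hence
(§3) **`avgM_transfer`**: `L^d·avgM n L s τ σ = PhiDC n (DgT) (coefT) τ σ` and **`avgM_transfer_sub_M`**: `L^d·avgM n L s τ σ − M n s τ σ =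
PhiDC n (DgT − Dg_n) (coefT − coef_n) τ σ` (linearity `PhiDC_sub`) — every letter of which FILE E estimates by `C(d,L)∕n²`; the SAME transfer lemma
applied at `(n₀, k)` to the cell-summed difference gives the tower step (FILE R), with FILE W's `L`-uniform weight bound.

0∕4 row-D1 binders touched.  NOT (CONV-C), NEVER «G-an2-4 closed», NOT the ghost step law, NOT SDF, NOT D1, NOT BetaPertH, NOT continuum, NOT Clay.
Provenance: prover-b2b-balaban-gan24-p3-g29-0 (unit `b2b-balaban-gan24-p3`, gen 29), 2026-08-21; no existing file touched.
-/

noncomputable section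

namespace Summit.QuantumFields.BalabanUV.Beta.FP.ConstrainedBiLaplacianSbTwoLevelTransfer

open Complex Finset ComplexConjugate
open Literature.MathematicalPhysics.QuantumFieldTheory.Balaban1983to89
open Literature.MathematicalPhysics.QuantumFieldTheory.Balaban1983to89.B4Strip
open Literature.MathematicalPhysics.QuantumFieldTheory.Balaban1983to89.B4StripCauchy
open Literature.MathematicalPhysics.QuantumFieldTheory.Balaban1983to89.B4StripSums
open Summit.QuantumFields.BalabanUV.Beta.FP.ConstrainedBiLaplacianStrip
open Summit.QuantumFields.BalabanUV.Beta.FP.ConstrainedBiLaplacianFibre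
open Summit.QuantumFields.BalabanUV.Beta.FP.ConstrainedBiLaplacianFibreEntries
open Summit.QuantumFields.BalabanUV.Beta.FP.ConstrainedBiLaplacianKernel
open Summit.QuantumFields.BalabanUV.Beta.FP.ConstrainedBiLaplacianSubcell (avgM)
open Summit.QuantumFields.BalabanUV.Beta.FP.ConstrainedBiLaplacianPairing (sum4_comm)
open Summit.QuantumFields.BalabanUV.Beta.FP.ConstrainedBiLaplacianSbTwoLevelSymbols
open Summit.QuantumFields.BalabanUV.Beta.FP.ConstrainedBiLaplacianSbTwoLevel
open Summit.QuantumFields.BalabanUV.Beta.GAN24.SubAveragingCore (Kof Kof_val Kof_ne_zero)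
open Summit.QuantumFields.BalabanUV.Beta.GAN24.SubAveragingCoreEstimate (W1)
open Summit.QuantumFields.BalabanUV.Beta.GAN24.SubAveragingFibreColumn (sum_Kof_eq Kof_injective)
open Summit.QuantumFields.BalabanUV.Beta.GAN24.SubAveragingKernel (Tsub)
open scoped Real

variable {d : ℕ}

/-! ## §1 The generic alias form `PhiDC` and its transfer under two-leg sub-cell summation -/

/-- [folklore] `Kof k m = Kof k′ m′ ↔ k = k′ ∧ m = m′`. -/
theorem Kof_eq_Kof_iff (n L : ℕ) [NeZero n] (k k' : Fin d → Fin n) (m m' : Fin d → Fin L) :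
    Kof n L k m = Kof n L k' m' ↔ k = k' ∧ m = m' := by
  constructor
  · intro h
    have := Kof_injective n L (a₁ := (k, m)) (a₂ := (k', m')) h
    exact ⟨congrArg Prod.fst this, congrArg Prod.snd this⟩
  · rintro ⟨rfl, rfl⟩; rfl

section Generic

variable (N : ℕ) [NeZero N] (p : Fin d → ℂ)

/-- [folklore] **THE GENERIC ALIAS FORM** of an offset-pair multiplier with diagonal letter `D` and rank-one coefficient `C`:
`PhiDC N D C τ σ p = N^{−d}·Σ_{KK′} EF N τ K·EFc N σ K′·([K=K′]·D K − F N 0 K·Fc N 0 K′·C K K′)`. -/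
def PhiDC (D : (Fin d → Fin N) → ℂ) (C : (Fin d → Fin N) → (Fin d → Fin N) → ℂ) (τ σ : Fin d → Fin N) : ℂ :=
  ((N : ℂ) ^ d)⁻¹ * ∑ K : Fin d → Fin N, ∑ K' : Fin d → Fin N, EF N τ K p * EFc N σ K' p *
    ((if K = K' then D K else 0) - F N (fun _ => 0) K p * Fc N (fun _ => 0) K' p * C K K')

/-- [folklore] `PhiDC` is linear in the pair `(D, C)`: differences. -/
theorem PhiDC_sub (D₁ D₂ : (Fin d → Fin N) → ℂ) (C₁ C₂ : (Fin d → Fin N) → (Fin d → Fin N) → ℂ) (τ σ : Fin d → Fin N) :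
    PhiDC N p D₁ C₁ τ σ - PhiDC N p D₂ C₂ τ σ = PhiDC N p (fun K => D₁ K - D₂ K) (fun K K' => C₁ K K' - C₂ K K') τ σ := by
  unfold PhiDC
  rw [← mul_sub, ← Finset.sum_sub_distrib]
  congr 1
  refine Finset.sum_congr rfl fun K _ => ?_
  rw [← Finset.sum_sub_distrib]
  refine Finset.sum_congr rfl fun K' _ => ?_
  split_ifs <;> ring

/-- [folklore] **THE MULTIPLIER IS THE ALIAS FORM OF `(Dg, coef)`**: `M N s τ σ = PhiDC N (Dg N s) (coef N s) τ σ`. -/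
theorem M_eq_PhiDC (s : ℕ) (τ σ : Fin d → Fin N) :
    M N s τ σ p = PhiDC N p (Dg N s p) (fun K K' => coef N s K K' p) τ σ := by
  rw [M_eq_sum]; rfl

end Generic

section TransferGeneric

variable (n L : ℕ) [NeZero n] [NeZero L] (p : Fin d → ℂ)

/-- [folklore] THE TRANSFERRED DIAGONAL LETTER of a finer `D′`: `trD D′ k = Σ_m W1(Kof k m)·D′(Kof k m)`. -/
def trD (D' : (Fin d → Fin (n * L)) → ℂ) (k : Fin d → Fin n) : ℂ := ∑ m : Fin d → Fin L, W1 n L (Kof n L k m) p * D' (Kof n L k m)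

/-- [folklore] THE TRANSFERRED RANK-ONE COEFFICIENT of a finer `C′`: `trC C′ k k′ = Σ_{mm′} W1(Kof k m)·W1(Kof k′ m′)·C′(Kof k m)(Kof k′ m′)`. -/
def trC (C' : (Fin d → Fin (n * L)) → (Fin d → Fin (n * L)) → ℂ) (k k' : Fin d → Fin n) : ℂ :=
  ∑ m : Fin d → Fin L, ∑ m' : Fin d → Fin L, W1 n L (Kof n L k m) p * W1 n L (Kof n L k' m') p * C' (Kof n L k m) (Kof n L k' m')

omit [NeZero n] [NeZero L] in
/-- [folklore] `trD`, `trC` are linear: differences. -/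
theorem trD_sub (D₁ D₂ : (Fin d → Fin (n * L)) → ℂ) (k : Fin d → Fin n) :
    trD n L p D₁ k - trD n L p D₂ k = trD n L p (fun K => D₁ K - D₂ K) k := by
  unfold trD; rw [← Finset.sum_sub_distrib]; exact Finset.sum_congr rfl fun m _ => by ring

omit [NeZero n] [NeZero L] in
/-- [folklore] differences of `trC`. -/
theorem trC_sub (C₁ C₂ : (Fin d → Fin (n * L)) → (Fin d → Fin (n * L)) → ℂ) (k k' : Fin d → Fin n) :
    trC n L p C₁ k k' - trC n L p C₂ k k' = trC n L p (fun K K' => C₁ K K' - C₂ K K') k k' := by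
  unfold trC
  rw [← Finset.sum_sub_distrib]
  refine Finset.sum_congr rfl fun m _ => ?_
  rw [← Finset.sum_sub_distrib]
  exact Finset.sum_congr rfl fun m' _ => by ring

variable (D' : (Fin d → Fin (n * L)) → ℂ) (C' : (Fin d → Fin (n * L)) → (Fin d → Fin (n * L)) → ℂ)

/-- [folklore] THE INNER DOUBLE SUM, DIAGONAL PART: `Σ_{mm′} GP(K) GM(K′)·[K = K′]·D′(K) = [k = k′]·trD D′ k`. -/
theorem inner_diag (k k' : Fin d → Fin n) :
    ∑ m : Fin d → Fin L, ∑ m' : Fin d → Fin L, GP n L (Kof n L k m) p * GM n L (Kof n L k' m') p *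
        (if Kof n L k m = Kof n L k' m' then D' (Kof n L k m) else 0)
      = if k = k' then trD n L p D' k else 0 := by
  by_cases hk : k = k'
  · subst hk
    rw [if_pos rfl]
    unfold trD
    refine Finset.sum_congr rfl fun m _ => ?_
    have e : ∀ m' : Fin d → Fin L, GP n L (Kof n L k m) p * GM n L (Kof n L k m') p *
        (if Kof n L k m = Kof n L k m' then D' (Kof n L k m) else 0)
        = if m = m' then GP n L (Kof n L k m) p * GM n L (Kof n L k m') p * D' (Kof n L k m) else 0 := by
      intro m'
      by_cases hm : m = m'
      · rw [if_pos hm, if_pos (by rw [hm])]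
      · rw [if_neg hm, if_neg (fun h => hm ((Kof_eq_Kof_iff n L k k m m').mp h).2), mul_zero]
    rw [Finset.sum_congr rfl (fun m' _ => e m'), Finset.sum_ite_eq Finset.univ m, if_pos (Finset.mem_univ _), GP_mul_GM]
  · rw [if_neg hk]
    exact Finset.sum_eq_zero fun m _ => Finset.sum_eq_zero fun m' _ => by
      rw [if_neg (fun h => hk ((Kof_eq_Kof_iff n L k k' m m').mp h).1), mul_zero]

/-- [folklore] THE INNER DOUBLE SUM, RANK-ONE PART: `Σ_{mm′} GP(K) GM(K′)·u′_K ũ′_{K′}·C′(K,K′) = u_k ũ_{k′}·trC C′ k k′` (the finer block-averaging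
factors split off the complementary half-weights, `F_zero_Kof`∕`Fc_zero_Kof`, and `GP·GM = W1` on BOTH legs). -/
theorem inner_rank_one (k k' : Fin d → Fin n) :
    ∑ m : Fin d → Fin L, ∑ m' : Fin d → Fin L, GP n L (Kof n L k m) p * GM n L (Kof n L k' m') p *
        (F (n * L) (fun _ => 0) (Kof n L k m) p * Fc (n * L) (fun _ => 0) (Kof n L k' m') p * C' (Kof n L k m) (Kof n L k' m'))
      = F n (fun _ => 0) k p * Fc n (fun _ => 0) k' p * trC n L p C' k k' := by
  unfold trC
  rw [Finset.mul_sum]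
  refine Finset.sum_congr rfl fun m _ => ?_
  rw [Finset.mul_sum]
  refine Finset.sum_congr rfl fun m' _ => ?_
  rw [F_zero_Kof, Fc_zero_Kof, ← GP_mul_GM, ← GP_mul_GM]
  ring

/-- [folklore] THE INNER DOUBLE SUM: `Σ_{mm′} GP(Kof k m)·GM(Kof k′ m′)·([K=K′]D′ − u′ũ′C′)(Kof k m, Kof k′ m′) = [k=k′]·trD D′ k − u_k ũ_{k′}·trC C′ k k′`. -/
theorem inner_eq (k k' : Fin d → Fin n) :
    ∑ m : Fin d → Fin L, ∑ m' : Fin d → Fin L, GP n L (Kof n L k m) p * GM n L (Kof n L k' m') p *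
        ((if Kof n L k m = Kof n L k' m' then D' (Kof n L k m) else 0)
          - F (n * L) (fun _ => 0) (Kof n L k m) p * Fc (n * L) (fun _ => 0) (Kof n L k' m') p * C' (Kof n L k m) (Kof n L k' m'))
      = (if k = k' then trD n L p D' k else 0) - F n (fun _ => 0) k p * Fc n (fun _ => 0) k' p * trC n L p C' k k' := by
  rw [← inner_diag, ← inner_rank_one, ← Finset.sum_sub_distrib]
  refine Finset.sum_congr rfl fun m _ => ?_
  rw [← Finset.sum_sub_distrib]
  refine Finset.sum_congr rfl fun m' _ => ?_
  rw [mul_sub]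

/-- [folklore] STEP 1 of the transfer: the offset sums move inside the alias sums. -/
theorem sum_sum_PhiDC_eq (τ σ : Fin d → Fin n) :
    ∑ ρ : Fin d → Fin L, ∑ ρ' : Fin d → Fin L, PhiDC (n * L) p D' C' (Tsub n L τ ρ) (Tsub n L σ ρ')
      = ((((n * L : ℕ) : ℂ)) ^ d)⁻¹ * ∑ K : Fin d → Fin (n * L), ∑ K' : Fin d → Fin (n * L),
          (∑ ρ : Fin d → Fin L, EF (n * L) (Tsub n L τ ρ) K p) * (∑ ρ' : Fin d → Fin L, EFc (n * L) (Tsub n L σ ρ') K' p)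
            * ((if K = K' then D' K else 0) - F (n * L) (fun _ => 0) K p * Fc (n * L) (fun _ => 0) K' p * C' K K') := by
  unfold PhiDC
  simp only [← Finset.mul_sum]
  congr 1
  simp only [Finset.sum_mul_sum]
  simp only [Finset.sum_mul]
  exact sum4_comm (fun ρ ρ' K K' => EF (n * L) (Tsub n L τ ρ) K p * EFc (n * L) (Tsub n L σ ρ') K' p *
    ((if K = K' then D' K else 0) - F (n * L) (fun _ => 0) K p * Fc (n * L) (fun _ => 0) K' p * C' K K'))

/-- [our proof] **THE GENERIC TWO-LEG TRANSFER**: `Σ_{ρρ′} PhiDC (n·L) D′ C′ (Tsub τ ρ) (Tsub σ ρ′) = L^d · PhiDC n (trD D′) (trC C′) τ σ` — the two-leg sub-cell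
SUM of a finer alias form is `L^d` times the coarse alias form of the TRANSFERRED letters (every `n, L ≥ 1`, every `D′, C′`, every complex `p`). -/
theorem sum_sum_PhiDC_Tsub (τ σ : Fin d → Fin n) :
    ∑ ρ : Fin d → Fin L, ∑ ρ' : Fin d → Fin L, PhiDC (n * L) p D' C' (Tsub n L τ ρ) (Tsub n L σ ρ')
      = (L : ℂ) ^ d * PhiDC n p (trD n L p D') (trC n L p C') τ σ := by
  have hn : (n : ℂ) ≠ 0 := Nat.cast_ne_zero.mpr (NeZero.ne n)
  have hL : (L : ℂ) ≠ 0 := Nat.cast_ne_zero.mpr (NeZero.ne L)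
  rw [sum_sum_PhiDC_eq, sum_Kof_eq n L]
  have e1 : ∀ (k : Fin d → Fin n) (m : Fin d → Fin L), ∑ K' : Fin d → Fin (n * L),
      (∑ ρ : Fin d → Fin L, EF (n * L) (Tsub n L τ ρ) (Kof n L k m) p) * (∑ ρ' : Fin d → Fin L, EFc (n * L) (Tsub n L σ ρ') K' p)
        * ((if Kof n L k m = K' then D' (Kof n L k m) else 0) - F (n * L) (fun _ => 0) (Kof n L k m) p * Fc (n * L) (fun _ => 0) K' p * C' (Kof n L k m) K')
      = ∑ k' : Fin d → Fin n, ∑ m' : Fin d → Fin L,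
          (L : ℂ) ^ d * (EF n τ k p * GP n L (Kof n L k m) p) * ((L : ℂ) ^ d * (EFc n σ k' p * GM n L (Kof n L k' m') p))
            * ((if Kof n L k m = Kof n L k' m' then D' (Kof n L k m) else 0)
                - F (n * L) (fun _ => 0) (Kof n L k m) p * Fc (n * L) (fun _ => 0) (Kof n L k' m') p * C' (Kof n L k m) (Kof n L k' m')) := by
    intro k m
    rw [sum_Kof_eq n L]
    refine Finset.sum_congr rfl fun k' _ => Finset.sum_congr rfl fun m' _ => ?_
    rw [sum_EF_Tsub, sum_EFc_Tsub]
  have e2 : ∀ k : Fin d → Fin n, ∑ m : Fin d → Fin L, ∑ K' : Fin d → Fin (n * L),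
      (∑ ρ : Fin d → Fin L, EF (n * L) (Tsub n L τ ρ) (Kof n L k m) p) * (∑ ρ' : Fin d → Fin L, EFc (n * L) (Tsub n L σ ρ') K' p)
        * ((if Kof n L k m = K' then D' (Kof n L k m) else 0) - F (n * L) (fun _ => 0) (Kof n L k m) p * Fc (n * L) (fun _ => 0) K' p * C' (Kof n L k m) K')
      = (L : ℂ) ^ d * (L : ℂ) ^ d * ∑ k' : Fin d → Fin n, EF n τ k p * EFc n σ k' p *
          ((if k = k' then trD n L p D' k else 0) - F n (fun _ => 0) k p * Fc n (fun _ => 0) k' p * trC n L p C' k k') := by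
    intro k
    rw [Finset.sum_congr rfl (fun m _ => e1 k m)]
    rw [Finset.sum_comm, Finset.mul_sum]
    refine Finset.sum_congr rfl fun k' _ => ?_
    rw [← inner_eq n L p D' C' k k']
    simp only [Finset.mul_sum]
    refine Finset.sum_congr rfl fun m _ => Finset.sum_congr rfl fun m' _ => ?_
    ring
  rw [Finset.sum_congr rfl (fun k _ => e2 k), ← Finset.mul_sum]
  unfold PhiDC
  push_cast
  field_simp
  ring

end TransferGeneric

/-! ## §2 The exact transfer identity for `avgM` and the one-step difference symbol -/

section Identity

variable (n L : ℕ) [NeZero n] [NeZero L] (s : ℕ) (p : Fin d → ℂ)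

/-- [folklore] `DgT = trD (Dg_{nL})`, `coefT = trC (coef_{nL})` (definitional). -/
theorem DgT_eq_trD (k : Fin d → Fin n) : DgT n L s p k = trD n L p (Dg (n * L) s p) k := rfl

/-- [folklore] `coefT = trC (coef_{nL})` (definitional). -/
theorem coefT_eq_trC (k k' : Fin d → Fin n) : coefT n L s p k k' = trC n L p (fun K K' => coef (n * L) s K K' p) k k' := rfl

/-- [folklore] `GT`'s alias form is `PhiDC n (DgT) (coefT)`. -/
theorem PhiDC_DgT_coefT (τ σ : Fin d → Fin n) :
    PhiDC n p (DgT n L s p) (coefT n L s p) τ σ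
      = ((n : ℂ) ^ d)⁻¹ * ∑ k : Fin d → Fin n, ∑ k' : Fin d → Fin n, EF n τ k p * EFc n σ k' p * GT n L s p k k' := rfl

/-- [our proof] **THE EXACT TRANSFER IDENTITY**: `L^d·avgM n L s τ σ p = PhiDC n (DgT) (coefT) τ σ p = n^{−d}·Σ_{kk′} EF·EFc·GT` — the two-leg sub-cell
average of the level-`n·L` offset-pair multiplier IS a level-`n`-type alias form with the transferred fibre entries. -/
theorem avgM_transfer (τ σ : Fin d → Fin n) :
    (L : ℂ) ^ d * avgM n L s τ σ p = PhiDC n p (DgT n L s p) (coefT n L s p) τ σ := by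
  have hL : (L : ℂ) ≠ 0 := Nat.cast_ne_zero.mpr (NeZero.ne L)
  have hLd : (L : ℂ) ^ d ≠ 0 := pow_ne_zero d hL
  unfold avgM
  simp_rw [M_eq_PhiDC]
  rw [sum_sum_PhiDC_Tsub]
  show (L : ℂ) ^ d * (((L : ℂ) ^ d)⁻¹ * (((L : ℂ) ^ d)⁻¹ * ((L : ℂ) ^ d *
    PhiDC n p (trD n L p (Dg (n * L) s p)) (trC n L p fun K K' => coef (n * L) s K K' p) τ σ))) = _
  field_simp
  rfl

/-- [our proof] **THE ONE-STEP DIFFERENCE SYMBOL IS THE ALIAS FORM OF THE LETTER DIFFERENCES**: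
`L^d·avgM n L s τ σ p − M n s τ σ p = PhiDC n (DgT − Dg_n) (coefT − coef_n) τ σ p`. -/
theorem avgM_transfer_sub_M (τ σ : Fin d → Fin n) :
    (L : ℂ) ^ d * avgM n L s τ σ p - M n s τ σ p
      = PhiDC n p (fun k => DgT n L s p k - Dg n s p k) (fun k k' => coefT n L s p k k' - coef n s k k' p) τ σ := by
  rw [avgM_transfer, M_eq_PhiDC, PhiDC_sub]

end Identity

end Summit.QuantumFields.BalabanUV.Beta.FP.ConstrainedBiLaplacianSbTwoLevelTransfer

end
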